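import Summits.QuantumFields.YangMills.Theorems.BalabanUVNodesN15TwoSpacingGluingAdjointLocalGauges
import Summits.QuantumFields.YangMills.Theorems.BalabanUVNodesN15CurvedGluingCubeAdjointGaugeConjugatedEntry
import HarnessLib

/-!
# THE ADJOINT CAPSTONE (dag-n15-w3 file 47 TRANSPOSED): ENTRY 2 `𝒢∘∇⁻_ν` OF THE ADJOINT GLUED OPERATOR BUILT FROM DRESSED SMOOTH-CUT CUBES, EACH IN ITS OWN (3.35) GAUGE, WITH EVERY PER-CUBE
# ROW DISCHARGED BY NAME from the flat cubes' cut rows and SANDWICHED right entries (file 34, FILE 153 ★★★, FILE 162 ★★, FILE 157 ★) — displayed: file 34's raw cube data, the flat sandwiches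
# `N_k∘∇^±_μ∘M_χ = T^±∘M_χ` and their rows, the partition's letters and its transition layers inside the cuts, the gauges `u_k` with `M_{u_k}ΔM_{u_kᵀ} = model_k + F_k` and the far defect's TWO
# ADJOINT rows, the pure-gauge coefficients' row letters, one smallness (dag-n15-c g18, FILE 163; N15 = NE2, s1 «background-layer OPERATOR ingredient»)

Cell `pub-ymgap`, seat `pub-ymgap-dag-n15-c` (R134 (a); HUMAN RULING D-0062), generation 18.  `bears_on: R4∕N15 · K3⁸ SpineGivenEndpointR13SepCoPHV (stmt-QuantumFields-27366)`.
Filed `--kind proof --supports stmt-QuantumFields-27366 --as helper` — COUNT-NEUTRAL.  Theorems only; 0 `def`, 0 `sorry`.  Imports BY NAME FILE 160 `…TwoSpacingGluingAdjointLocalGauges`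
(`hasMaj_gluedL_comp_of_localGauges`) and FILE 162 `…CubeAdjointGaugeConjugatedEntry` (`smoothCutDressed_gaugeConj_bgrad_sandwich`; through them FILE 153 ★★★ ∕ ★, FILE 157 ★, file 34
`hasMaj_smoothCutDressed_loc₂` ∕ `mulOp_comp_smoothCutDressed` ∕ `hasMaj_smoothCut_flat` ∕ `hasMaj_jet_smoothCut_flat`, file 23 `hasMaj_dressedV_pair`, FILE 148 `isUnit_neumannR`, file 44
`weight_mul_exp_rate_mono`, dag-n15-c `commOp_add_left`).  Nothing in the tree is modified; nothing restated.

WHY.  dag-n15-w3's file 47 is the DIRECT-side capstone: file 44's per-cube rows formed IN THE CUBES' GAUGES, glued by dag-n15-w2's `hasMaj_glued_of_localGauges`.  THIS FILE is its adjoint twin for the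
entry-2 letter `E := ∇⁻_ν` (FINDING (ix): `𝒢∘∇^{U*} = Σ_ν[(𝒢∘∇⁻_ν)∘M_{R_ν∘e} − 𝒢∘M_{∇R_ν} + 𝒢∘M_{B_ν}]`, FILE 159): per cube the dressed smooth-cut cube `X_k` at the (cut, `unstackM`-form)
perturbation `V̂_k = unstackM C_k A_k + N_V k∘pr₀` (FINDING (x)); its cut row (file 34), its OUTPUT-localized adjoint remainder row against the model operator (FILE 153 ★★★) plus the far row
`X_k∘[F_k, M_{h_k}]` (displayed), its sandwich against `M_{u_k}∇⁻_νM_{u_kᵀ}` (FILE 162 ★★: pure-gauge transporter `R₁ = u_k·(u_kᵀ∘e⁻¹)`, connection part `B₁`) with the sandwiched operator's row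
(FILE 157 ★ on FILE 153 ★ and file 34), the right-locality defect `Ẽ_k := X_k∘F_k∘M_{h_k}` (displayed row; `V_m = 0`, flat right locality exact are NOT needed for the row), then FILE 160 ★★★.

WHAT.  `mulOp_fst_comp_bgrad_leib` (the scalar adjoint Leibniz rule of `∇⁻` on the vector carrier); ★★★ `hasMaj_gluedL_bgrad_smoothCutDressed_localGauges`:
`glueInvL (R̃ − Σ_kM_{h_k}(M_{u_kᵀ}Ẽ_kM_{u_k})) (Σ_kM_{h_k}(M_{u_kᵀ}X_kM_{u_k})M_{h_k}) ∘ ∇⁻_ν ≤ (1 − N_ov|ι|²(Θ + θ_F + ε_F)c_r)⁻¹·N_ov|ι|²(β₂ + β̄′c₁)·c_r·e^{−(ρ₃−2σ)d}`,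
`β₂ = β^Xr_R + β̄′r_{∇R} + β̄′r_B`, `Θ` = FILE 153's constant, `β̄′ = β̄(1 − β̄Rc_r²)⁻¹`, `β^X = (1 − θ_𝒲c_r)⁻¹β^Qc_r`.

HONEST FRAMING ∕ LIMITS.  Composition of LANDED theorems over DISPLAYED rows — the operator-level content of entry 2 of (3.42) with (3.34)–(3.35)'s per-cube gauges as a CONDITIONAL statement on King's ∕
dag-n15-a's model carriers; proves NO estimate of a concrete propagator; nothing of [B5]∕[B6]∕[B9] asserted ((2.91)–(2.93) p.239, (2.133)–(2.136) p.247, (3.34)–(3.35) p.396, (3.42) p.397, (3.52)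
p.400, (3.62)–(3.65) pp.402–403, (3.76)–(3.77) pp.405–406, (3.87) p.409 = SHAPES ∕ MECHANISM).  NE2⁺ NOT PRINTED, NOT proved; N15 NOT discharged; K3⁸ OPEN, skeleton v7 untouched (0∕2); counts of
record UNMOVED by this seat (typed 28∕28 · discharged 7∕28 = 7∕27 excl. NODE O, №245); one finite 𝕋⁴ at fixed ε — NOT infinite volume, NOT OS on ℝ⁴, NOT a mass gap, NOT Clay; R4 closes the
conditional finite-𝕋⁴ rung `BalabanLadder.UV` only.  Restate-immune (no Theses import).
-/

set_option autoImplicit false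

noncomputable section
open scoped BigOperators Matrix
open Finset

namespace Summit.QuantumFields.YangMills.BalabanUVNodes.N15.Gluing

open Literature.MathematicalPhysics.QuantumFieldTheory.Balaban1983to89
open Literature.MathematicalPhysics.QuantumFieldTheory.Balaban1983to89.B11SectG (BlockNorm HasMaj RowSum)
open Literature.MathematicalPhysics.QuantumFieldTheory.Balaban1983to89.B6RandomWalk (Triangle254)
open Literature.MathematicalPhysics.QuantumFieldTheory.Balaban1983to89.T4EtaRateCoeffDefect (diagK diagK_nonneg hasMaj_mulOp)
open Literature.MathematicalPhysics.QuantumFieldTheory.Balaban1983to89.B6Prop26Gluing (mulOp mulOp_apply ind ind_nonneg ind_le_one)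
open Summit.QuantumFields.YangMills.BalabanUVNodes.N15.MatrixSpecies (mmulOp liftBlk liftEquiv liftEquiv_apply liftEquiv_symm_apply)
open Summit.QuantumFields.YangMills.BalabanUVNodes.N15.BackgroundLayer (fgrad bgrad fgradAdj fgrad_apply bgrad_apply stack projO unstackM bgPropV blkPair fgradMat)
open Summit.QuantumFields.YangMills.BalabanUVNodes.N15.CurvedSpecies (hasMaj_smoothCutDressed_loc₂ mulOp_comp_smoothCutDressed hasMaj_smoothCut_flat hasMaj_jet_smoothCut_flat smoothCut_out
  hasMaj_dressedV_pair)

/-! ## §1 The scalar adjoint Leibniz rule of `∇⁻` on the vector carrier -/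

section Leibniz

variable {X ι : Type} [Fintype ι]

omit [Fintype ι] in
/-- `M_h∘∇⁻_e = ∇⁻_e∘M_{h∘e} + M_{−∇⁺_eh}` for an ι-constant `h` (FILE 49 `mulOp_comp_bgrad`, in the shape FILE 83∕158∕160's `hleib` wants). [cite: Balaban1984PropagatorsII, p.239 («Using the formulas (1.126)–(1.128)»)] -/
theorem mulOp_fst_comp_bgrad_leib (n : ℝ) (e : X ≃ X) (h : X → ℝ) :
    mulOp (fun p : X × ι => h p.1) ∘ₗ bgrad n (liftEquiv e ι) =
      bgrad n (liftEquiv e ι) ∘ₗ mulOp (fun p : X × ι => h (e p.1)) + mulOp (fun p : X × ι => -(fgrad n e h p.1)) := by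
  refine LinearMap.ext fun f => funext fun p => ?_
  simp only [LinearMap.comp_apply, LinearMap.add_apply, Pi.add_apply, mulOp_apply, bgrad_apply, fgrad_apply, liftEquiv_symm_apply, Equiv.apply_symm_apply]
  ring

end Leibniz

/-! ## §2 The adjoint capstone -/

section Capstone

variable {X ι J K : Type} [Fintype X] [DecidableEq X] [Fintype ι] [DecidableEq ι] [Fintype J] [DecidableEq J] [Fintype K] {g : B6.Geometry} (blk : X → g.Site) (τ : J → X ≃ X) (n : ℝ) (ν : J)
  {σ cr : ℝ} {N : K → (X × ι → ℝ) →ₗ[ℝ] (X × ι → ℝ)} {C : K → X → Matrix ι ι ℝ} {A : K → J ⊕ J → X → Matrix ι ι ℝ} {NV : K → (X × ι → ℝ) →ₗ[ℝ] (X × ι → ℝ)}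
  {Δ W NL : (X × ι → ℝ) →ₗ[ℝ] (X × ι → ℝ)} {F : K → (X × ι → ℝ) →ₗ[ℝ] (X × ι → ℝ)} {ug : K → X → Matrix ι ι ℝ} {χX χtX ψX ψ₂X hX : K → X → ℝ} {Sk : K → Set g.Site}
  {hb : K → g.Site → ℝ} {Tf Tb : K → J → (X × ι → ℝ) →ₗ[ℝ] (X × ι → ℝ)}

/-- ★★★ **ENTRY 2 `𝒢∘∇⁻_ν` OF THE ADJOINT GLUED OPERATOR FROM DRESSED SMOOTH-CUT CUBES IN PER-CUBE GAUGES, EVERY CUBE ROW BY NAME** — FILE 160 `hasMaj_gluedL_comp_of_localGauges` with, per cube `k` IN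
ITS GAUGE `u_k`: the cut row of `X_k` (file 34), the adjoint remainder row `X_k∘[model_k, M_{h_k}]` (FILE 153 ★★★) plus the far row `X_k∘[F_k, M_{h_k}]`, the sandwich of `X_k` against
`M_{u_k}∇⁻_νM_{u_kᵀ}` (FILE 162 ★★) and its row (FILE 157 ★ on FILE 153 ★ and file 34), the defect row `X_k∘F_k∘M_{h_k}`; the scalar adjoint Leibniz rule of `∇⁻_ν` (§1).  Displayed: file 34's
cube data per `k` (cut rows `β, β₁` of `N_k`, bump letters∕insertions, input cuts, `V̂_k ≤ Re^{−δ_Vd}`, `β̄Rc_r² < 1`), the adjoint letters `𝒲_k ≤ θ_𝒲e^{−δ_Wd}` (`θ_𝒲c_r < 1`; FILE 150 supplies them),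
the flat sandwiches `N_k∘∇^±_μ∘M_{χ_k} = T^±∘M_{χ_k}` with rows `β^Q` and input cuts `ψ₂`, the partition (`|h| ≤ 1`, `M_hM_χ = M_h`, letters `c₀, c₁, c₂`, block reading `ℓ, ω`, transition layers and
the `ν`-shifted support inside `{χ_k = 1}`), species rows `r_A`, `W`-rows `θ_W`, `[N_L, M_h] ≤ c_Ne^{−ρ_Nd}`, base parts `R_N`, overlap `N_ov`, orthogonal gauges `u_k` with
`M_{u_k}ΔM_{u_kᵀ} = model_k + F_k` and the far rows `X_k∘[F_k, M_{h_k}] ≤ 1_S(y)·θ_F`, `X_k∘F_k∘M_{h_k} ≤ 1_S1_S·ε_F` (rate `ρ₃`), the pure-gauge coefficient rows `r_R, r_{∇R}, r_B`, rates as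
in FILE 153 with `2σ ≤ ρ₃`, and ONE smallness `N_ov(|ι|²(Θ + θ_F) + |ι|²ε_F)c_r < 1`. [cite: Balaban1985BackgroundPropagators, (3.34)–(3.35) p.396, (3.42) p.397 (entry `G∇*_U`), (3.52) p.400, (3.62)–(3.65) pp.402–403, (3.76)–(3.77) pp.405–406, (3.87) p.409; Balaban1984PropagatorsI, (1.120)–(1.128) pp.37–39; Balaban1984PropagatorsII, (2.91)–(2.93) p.239, (2.133)–(2.136) p.247 (shapes + mechanism, transposed)] -/
theorem hasMaj_gluedL_bgrad_smoothCutDressed_localGauges (htri : Triangle254 g) (hd : ∀ a b : g.Site, 0 ≤ g.dist a b) (hsymm : ∀ y y', g.dist y y' = g.dist y' y)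
    (hd0 : ∀ y : g.Site, g.dist y y = 0) (hrow : RowSum g σ cr) (hσ : 0 ≤ σ)
    {ρ₁ ρ₂ ρ₃ ρN δV δN δW ε R c₀ c₁ c₂ θW cN rA RN ℓ ω β β₁ ct δ βQ θA θF εF rR rR' rB Nov : ℝ}
    (hβ : 0 ≤ β) (hβ₁ : 0 ≤ β₁) (hβQ : 0 ≤ βQ) (hct : 0 ≤ ct) (hR : 0 ≤ R) (hcr : 0 ≤ cr) (hc₀ : 0 ≤ c₀) (hc₁ : 0 ≤ c₁) (hc₂ : 0 ≤ c₂) (hθW : 0 ≤ θW) (hcN : 0 ≤ cN) (hrA : 0 ≤ rA)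
    (hRN : 0 ≤ RN) (hℓ : 0 ≤ ℓ) (hω : 0 ≤ ω) (hθA : 0 ≤ θA) (hθF : 0 ≤ θF) (hεF : 0 ≤ εF) (hrR : 0 ≤ rR) (hrR' : 0 ≤ rR') (hrB : 0 ≤ rB) (hNov : 0 ≤ Nov) (hε : 0 < ε)
    (hσρ : σ ≤ ρ₁) (hρ₁V : ρ₁ ≤ δV) (hρ₁G : ρ₁ + σ ≤ δ) (hρ₂ : 0 ≤ ρ₂) (hρ₂₁ : ρ₂ + σ ≤ ρ₁) (hρ₃ : 0 ≤ ρ₃) (hρ₃N : ρ₃ ≤ ρN) (hρ₃V : ρ₃ ≤ δN - ε) (hρ₃₂ : ρ₃ + σ ≤ ρ₂)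
    (hρ₂W : ρ₂ + 2 * σ ≤ δW) (hσρ₃ : 2 * σ ≤ ρ₃)
    -- per cube: cuts (supports over `S_k`, bump letters and insertions, input cuts)
    (hSχ : ∀ k x, χX k x ≠ 0 → blk x ∈ Sk k) (hSψ : ∀ k x, ψX k x ≠ 0 → blk x ∈ Sk k) (hSψ₂ : ∀ k x, ψ₂X k x ≠ 0 → blk x ∈ Sk k) (hχt : ∀ k x, |χtX k x| ≤ 1) (hχ1 : ∀ k x, |χX k x| ≤ 1)
    (hdχt : ∀ k μ p, |fgrad n (liftEquiv (τ μ) ι) (fun p : X × ι => χtX k p.1) p| ≤ ct) (hdχtb : ∀ k μ p, |bgrad n (liftEquiv (τ μ) ι) (fun p : X × ι => χtX k p.1) p| ≤ ct)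
    (hsub : ∀ k, mulOp (fun p : X × ι => χtX k p.1) ∘ₗ mulOp (fun p : X × ι => χX k p.1) = mulOp (fun p : X × ι => χtX k p.1))
    (hχ : ∀ k, mulOp (fun p : X × ι => χX k p.1) ∘ₗ mulOp (fun p : X × ι => χtX k p.1) = mulOp (fun p : X × ι => χtX k p.1))
    (hs : ∀ k μ, mulOp ((fun p : X × ι => χtX k p.1) ∘ (liftEquiv (τ μ) ι)) ∘ₗ mulOp (fun p : X × ι => χX k p.1) = mulOp ((fun p : X × ι => χtX k p.1) ∘ (liftEquiv (τ μ) ι)))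
    (hsb : ∀ k μ, mulOp ((fun p : X × ι => χtX k p.1) ∘ (liftEquiv (τ μ) ι).symm) ∘ₗ mulOp (fun p : X × ι => χX k p.1) = mulOp ((fun p : X × ι => χtX k p.1) ∘ (liftEquiv (τ μ) ι).symm))
    (hdd : ∀ k μ, mulOp (fgrad n (liftEquiv (τ μ) ι) (fun p : X × ι => χtX k p.1)) ∘ₗ mulOp (fun p : X × ι => χX k p.1) = mulOp (fgrad n (liftEquiv (τ μ) ι) (fun p : X × ι => χtX k p.1)))
    (hddb : ∀ k μ, mulOp (bgrad n (liftEquiv (τ μ) ι) (fun p : X × ι => χtX k p.1)) ∘ₗ mulOp (fun p : X × ι => χX k p.1) = mulOp (bgrad n (liftEquiv (τ μ) ι) (fun p : X × ι => χtX k p.1)))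
    (hNψ : ∀ k, N k ∘ₗ mulOp (fun p : X × ι => ψX k p.1) = N k)
    -- per cube: the flat cube's cut rows, SANDWICHED right entries with rows and input cuts
    (hcut : ∀ k, HasMaj (BlockNorm.ofBlocks g (liftBlk blk ι)) (BlockNorm.ofBlocks g (liftBlk blk ι)) (mulOp (fun p : X × ι => χX k p.1) ∘ₗ N k) (fun y y' => ind (Sk k) y * ind (Sk k) y' * (β * Real.exp (-(δ * g.dist y y')))))
    (hcutF : ∀ k μ, HasMaj (BlockNorm.ofBlocks g (liftBlk blk ι)) (BlockNorm.ofBlocks g (liftBlk blk ι)) (mulOp (fun p : X × ι => χX k p.1) ∘ₗ (fgrad n (liftEquiv (τ μ) ι) ∘ₗ N k)) (fun y y' => ind (Sk k) y * ind (Sk k) y' * (β₁ * Real.exp (-(δ * g.dist y y')))))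
    (hcutB : ∀ k μ, HasMaj (BlockNorm.ofBlocks g (liftBlk blk ι)) (BlockNorm.ofBlocks g (liftBlk blk ι)) (mulOp (fun p : X × ι => χX k p.1) ∘ₗ (bgrad n (liftEquiv (τ μ) ι) ∘ₗ N k)) (fun y y' => ind (Sk k) y * ind (Sk k) y' * (β₁ * Real.exp (-(δ * g.dist y y')))))
    (hTf : ∀ k μ, N k ∘ₗ fgrad n (liftEquiv (τ μ) ι) ∘ₗ mulOp (fun p : X × ι => χX k p.1) = Tf k μ ∘ₗ mulOp (fun p : X × ι => χX k p.1))
    (hTb : ∀ k μ, N k ∘ₗ bgrad n (liftEquiv (τ μ) ι) ∘ₗ mulOp (fun p : X × ι => χX k p.1) = Tb k μ ∘ₗ mulOp (fun p : X × ι => χX k p.1))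
    (hTfr : ∀ k μ, HasMaj (BlockNorm.ofBlocks g (liftBlk blk ι)) (BlockNorm.ofBlocks g (liftBlk blk ι)) (Tf k μ) (fun y y' => ind (Sk k) y * ind (Sk k) y' * (βQ * Real.exp (-(δW * g.dist y y')))))
    (hTbr : ∀ k μ, HasMaj (BlockNorm.ofBlocks g (liftBlk blk ι)) (BlockNorm.ofBlocks g (liftBlk blk ι)) (Tb k μ) (fun y y' => ind (Sk k) y * ind (Sk k) y' * (βQ * Real.exp (-(δW * g.dist y y')))))
    (hTfψ : ∀ k μ, Tf k μ ∘ₗ mulOp (fun p : X × ι => ψ₂X k p.1) = Tf k μ) (hTbψ : ∀ k μ, Tb k μ ∘ₗ mulOp (fun p : X × ι => ψ₂X k p.1) = Tb k μ)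
    -- per cube: the perturbation's letter, smallness, the adjoint letter of `𝒲_k`
    (hV : ∀ k, HasMaj (BlockNorm.ofBlocks g (blkPair (liftBlk blk ι))) (BlockNorm.ofBlocks g (liftBlk blk ι)) (unstackM (C k) (A k) + NV k ∘ₗ projO (none : Option (J ⊕ J))) (fun y y' => R * Real.exp (-(δV * g.dist y y'))))
    (hq : (β + (β₁ + ct * β)) * (R * cr) * cr < 1)
    (hW𝒲 : ∀ k, HasMaj (BlockNorm.ofBlocks g (liftBlk blk ι)) (BlockNorm.ofBlocks g (liftBlk blk ι))
      ((mulOp (fun p : X × ι => χtX k p.1) ∘ₗ N k) ∘ₗ (unstackM (C k) (A k) + NV k ∘ₗ projO (none : Option (J ⊕ J))) ∘ₗ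
        stack LinearMap.id (fun j => Sum.elim (fun μ => fgrad n (liftEquiv (τ μ) ι)) (fun μ => bgrad n (liftEquiv (τ μ) ι)) j) ∘ₗ mulOp (fun p : X × ι => χX k p.1))
      (fun y y' => θA * Real.exp (-(δW * g.dist y y')))) (hqA : θA * cr < 1)
    -- per cube: the partition and its transition layers inside the cut (also shifted by `e_ν`)
    (hhabs : ∀ k x, |hX k x| ≤ 1) (hhcut : ∀ k, mulOp (fun p : X × ι => hX k p.1) ∘ₗ mulOp (fun p : X × ι => χX k p.1) = mulOp (fun p : X × ι => hX k p.1))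
    (hh1 : ∀ k μ x, |fgrad n (τ μ) (hX k) x| ≤ c₁) (hh1b : ∀ k μ x, |bgrad n (τ μ) (hX k) x| ≤ c₁) (hh0 : ∀ k μ x, |hX k (τ μ x) - hX k x| ≤ c₀)
    (hLip : ∀ k y y', |hb k y - hb k y'| ≤ ℓ * g.dist y y') (hrh : ∀ k x, |hX k x - hb k (blk x)| ≤ ω)
    (hh2 : ∀ k μ p, |fgradAdj n (liftEquiv (τ μ) ι) (fgrad n (liftEquiv (τ μ) ι) (fun p : X × ι => hX k p.1)) p| ≤ c₂)
    (hh2f : ∀ k μ p, |fgrad n (liftEquiv (τ μ) ι) (fgrad n (liftEquiv (τ μ) ι) (fun p : X × ι => hX k p.1)) p| ≤ c₂)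
    (hh2b : ∀ k μ p, |bgrad n (liftEquiv (τ μ) ι) (bgrad n (liftEquiv (τ μ) ι) (fun p : X × ι => hX k p.1) ∘ ⇑(liftEquiv (τ μ) ι)) p| ≤ c₂)
    (hlayf : ∀ k μ x, hX k x ≠ hX k ((τ μ).symm x) → χX k x = 1) (hlayb : ∀ k μ x, hX k (τ μ x) ≠ hX k x → χX k x = 1) (hlayν : ∀ k x, hX k (τ ν x) ≠ 0 → χX k x = 1)
    -- per cube: species rows, `W`-row, the flat nonlocal commutator letter, base part; overlap
    (hA : ∀ k j x i, ∑ l, |A k j x i l| ≤ rA)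
    (hWrow : ∀ k, HasMaj (BlockNorm.ofBlocks g (liftBlk blk ι)) (BlockNorm.ofBlocks g (liftBlk blk ι)) ((projO none ∘ₗ bgPropV (stack (mulOp (fun p : X × ι => χtX k p.1) ∘ₗ N k) (fun j => Sum.elim (fun μ => fgrad n (liftEquiv (τ μ) ι)) (fun μ => bgrad n (liftEquiv (τ μ) ι)) j ∘ₗ (mulOp (fun p : X × ι => χtX k p.1) ∘ₗ N k))) (unstackM (C k) (A k) + NV k ∘ₗ projO (none : Option (J ⊕ J)))) ∘ₗ commOp W (fun p : X × ι => hX k p.1)) (fun y y' => ind (Sk k) y * ind (Sk k) y' * (θW * Real.exp (-(ρ₂ * g.dist y y')))))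
    (hKN : ∀ k, HasMaj (BlockNorm.ofBlocks g (liftBlk blk ι)) (BlockNorm.ofBlocks g (liftBlk blk ι)) (commOp NL (fun p : X × ι => hX k p.1)) (fun y y' => cN * Real.exp (-(ρN * g.dist y y'))))
    (hNV : ∀ k, HasMaj (BlockNorm.ofBlocks g (liftBlk blk ι)) (BlockNorm.ofBlocks g (liftBlk blk ι)) (NV k) (fun y y' => RN * Real.exp (-(δN * g.dist y y'))))
    (hN : ∀ a, ∑ k, ind (Sk k) a ≤ Nov)
    -- per cube: the ORTHOGONAL gauge, the GLOBAL operator read in it, the far defect's two adjoint rows, the pure-gauge coefficients' rows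
    (hug : ∀ k x, ug k x * (ug k x)ᵀ = 1) (hug' : ∀ k x, (ug k x)ᵀ * ug k x = 1)
    (hcov : ∀ k, mmulOp (ug k) ∘ₗ Δ ∘ₗ mmulOp (fun x => (ug k x)ᵀ) = (lapOp n (fun μ => liftEquiv (τ μ) ι) W + NL - (unstackM (C k) (A k) + NV k ∘ₗ projO (none : Option (J ⊕ J))) ∘ₗ stack LinearMap.id (fun j => Sum.elim (fun μ => fgrad n (liftEquiv (τ μ) ι)) (fun μ => bgrad n (liftEquiv (τ μ) ι)) j)) + F k)
    (hFK : ∀ k, HasMaj (BlockNorm.ofBlocks g (liftBlk blk ι)) (BlockNorm.ofBlocks g (liftBlk blk ι)) ((projO none ∘ₗ bgPropV (stack (mulOp (fun p : X × ι => χtX k p.1) ∘ₗ N k) (fun j => Sum.elim (fun μ => fgrad n (liftEquiv (τ μ) ι)) (fun μ => bgrad n (liftEquiv (τ μ) ι)) j ∘ₗ (mulOp (fun p : X × ι => χtX k p.1) ∘ₗ N k))) (unstackM (C k) (A k) + NV k ∘ₗ projO (none : Option (J ⊕ J)))) ∘ₗ commOp (F k) (fun p : X × ι => hX k p.1)) (fun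 y y' => ind (Sk k) y * (θF * Real.exp (-(ρ₃ * g.dist y y')))))
    (hFX : ∀ k, HasMaj (BlockNorm.ofBlocks g (liftBlk blk ι)) (BlockNorm.ofBlocks g (liftBlk blk ι)) ((projO none ∘ₗ bgPropV (stack (mulOp (fun p : X × ι => χtX k p.1) ∘ₗ N k) (fun j => Sum.elim (fun μ => fgrad n (liftEquiv (τ μ) ι)) (fun μ => bgrad n (liftEquiv (τ μ) ι)) j ∘ₗ (mulOp (fun p : X × ι => χtX k p.1) ∘ₗ N k))) (unstackM (C k) (A k) + NV k ∘ₗ projO (none : Option (J ⊕ J)))) ∘ₗ F k ∘ₗ mulOp (fun p : X × ι => hX k p.1)) (fun y y' => ind (Sk k) y * ind (Sk k) y' * (εF * Real.exp (-(ρ₃ * g.dist y y')))))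
    (hR1 : ∀ k x i, ∑ j, |((fun x => ug k x * (ug k ((τ ν).symm x))ᵀ) ∘ ⇑(τ ν)) x i j| ≤ rR) (hR1' : ∀ k x i, ∑ j, |(fgradMat n (τ ν) (fun x => ug k x * (ug k ((τ ν).symm x))ᵀ)) x i j| ≤ rR') (hB1 : ∀ k x i, ∑ j, |(fun x => ug k x * fgradMat n (τ ν) (fun y => (ug k ((τ ν).symm y))ᵀ) x) x i j| ≤ rB)
    (hqL : Nov * ((Fintype.card ι : ℝ) ^ 2 * ((((((Fintype.card J : ℝ) * (3 * ((β + (β₁ + ct * β)) * (1 - (β + (β₁ + ct * β)) * (R * cr) * cr)⁻¹ * c₂) + 2 * (((1 - θA * cr)⁻¹ * βQ * cr) * c₁)) + θW)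
          + (β + (β₁ + ct * β)) * (1 - (β + (β₁ + ct * β)) * (R * cr) * cr)⁻¹ * cN * cr)
        + (((Fintype.card J : ℝ) * (2 * rA * (c₁ * ((β + (β₁ + ct * β)) * (1 - (β + (β₁ + ct * β)) * (R * cr) * cr)⁻¹) + c₀ * ((1 - θA * cr)⁻¹ * βQ * cr))))
          + (β + (β₁ + ct * β)) * (1 - (β + (β₁ + ct * β)) * (R * cr) * cr)⁻¹ * ((ℓ * (Real.exp 1 * ε)⁻¹ + 2 * ω) * RN) * cr))) + θF) + (Fintype.card ι : ℝ) ^ 2 * εF) * cr < 1) :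
    HasMaj (BlockNorm.ofBlocks g (liftBlk blk ι)) (BlockNorm.ofBlocks g (liftBlk blk ι))
      (glueInvL (remainderL Δ (fun k => fun p : X × ι => hX k p.1) (fun k => (mmulOp (fun x => (ug k x)ᵀ) ∘ₗ (projO none ∘ₗ bgPropV (stack (mulOp (fun p : X × ι => χtX k p.1) ∘ₗ N k) (fun j => Sum.elim (fun μ => fgrad n (liftEquiv (τ μ) ι)) (fun μ => bgrad n (liftEquiv (τ μ) ι)) j ∘ₗ (mulOp (fun p : X × ι => χtX k p.1) ∘ₗ N k))) (unstackM (C k) (A k) + NV k ∘ₗ projO (none : Option (J ⊕ J)))) ∘ₗ mmulOp (ug k))) -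
          ∑ k, mulOp (fun p : X × ι => hX k p.1) ∘ₗ (mmulOp (fun x => (ug k x)ᵀ) ∘ₗ ((projO none ∘ₗ bgPropV (stack (mulOp (fun p : X × ι => χtX k p.1) ∘ₗ N k) (fun j => Sum.elim (fun μ => fgrad n (liftEquiv (τ μ) ι)) (fun μ => bgrad n (liftEquiv (τ μ) ι)) j ∘ₗ (mulOp (fun p : X × ι => χtX k p.1) ∘ₗ N k))) (unstackM (C k) (A k) + NV k ∘ₗ projO (none : Option (J ⊕ J)))) ∘ₗ F k ∘ₗ mulOp (fun p : X × ι => hX k p.1)) ∘ₗ mmulOp (ug k)))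
        (parametrix (fun k => fun p : X × ι => hX k p.1) (fun k => (mmulOp (fun x => (ug k x)ᵀ) ∘ₗ (projO none ∘ₗ bgPropV (stack (mulOp (fun p : X × ι => χtX k p.1) ∘ₗ N k) (fun j => Sum.elim (fun μ => fgrad n (liftEquiv (τ μ) ι)) (fun μ => bgrad n (liftEquiv (τ μ) ι)) j ∘ₗ (mulOp (fun p : X × ι => χtX k p.1) ∘ₗ N k))) (unstackM (C k) (A k) + NV k ∘ₗ projO (none : Option (J ⊕ J)))) ∘ₗ mmulOp (ug k)))) ∘ₗ bgrad n (liftEquiv (τ ν) ι))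
      (fun y y' => (1 - Nov * ((Fintype.card ι : ℝ) ^ 2 * ((((((Fintype.card J : ℝ) * (3 * ((β + (β₁ + ct * β)) * (1 - (β + (β₁ + ct * β)) * (R * cr) * cr)⁻¹ * c₂) + 2 * (((1 - θA * cr)⁻¹ * βQ * cr) * c₁)) + θW)
          + (β + (β₁ + ct * β)) * (1 - (β + (β₁ + ct * β)) * (R * cr) * cr)⁻¹ * cN * cr)
        + (((Fintype.card J : ℝ) * (2 * rA * (c₁ * ((β + (β₁ + ct * β)) * (1 - (β + (β₁ + ct * β)) * (R * cr) * cr)⁻¹) + c₀ * ((1 - θA * cr)⁻¹ * βQ * cr))))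
          + (β + (β₁ + ct * β)) * (1 - (β + (β₁ + ct * β)) * (R * cr) * cr)⁻¹ * ((ℓ * (Real.exp 1 * ε)⁻¹ + 2 * ω) * RN) * cr))) + θF) + (Fintype.card ι : ℝ) ^ 2 * εF) * cr)⁻¹ * (Nov * ((Fintype.card ι : ℝ) ^ 2 * (((1 - θA * cr)⁻¹ * βQ * cr) * rR + ((β + (β₁ + ct * β)) * (1 - (β + (β₁ + ct * β)) * (R * cr) * cr)⁻¹) * rR' + ((β + (β₁ + ct * β)) * (1 - (β + (β₁ + ct * β)) * (R * cr) * cr)⁻¹) * rB) * 1 + (Fintype.card ι : ℝ) ^ 2 * ((β + (β₁ + ct * β)) * (1 - (β + (β₁ + ct * β)) * (R * cr) * cr)⁻¹) * c₁)) * cr *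
        Real.exp (-((ρ₃ - 2 * σ) * g.dist y y'))) := by
  have hβb : 0 ≤ β + (β₁ + ct * β) := by positivity
  have hB : 0 ≤ ((β + (β₁ + ct * β)) * (1 - (β + (β₁ + ct * β)) * (R * cr) * cr)⁻¹) := mul_nonneg hβb (inv_nonneg.2 (by linarith))
  have hinv : 0 ≤ (1 - θA * cr)⁻¹ := inv_nonneg.2 (by linarith)
  have hBX : 0 ≤ ((1 - θA * cr)⁻¹ * βQ * cr) := mul_nonneg (mul_nonneg hinv hβQ) hcr
  have hΘ : 0 ≤ ((((Fintype.card J : ℝ) * (3 * ((β + (β₁ + ct * β)) * (1 - (β + (β₁ + ct * β)) * (R * cr) * cr)⁻¹ * c₂) + 2 * (((1 - θA * cr)⁻¹ * βQ * cr) * c₁)) + θW)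
          + (β + (β₁ + ct * β)) * (1 - (β + (β₁ + ct * β)) * (R * cr) * cr)⁻¹ * cN * cr)
        + (((Fintype.card J : ℝ) * (2 * rA * (c₁ * ((β + (β₁ + ct * β)) * (1 - (β + (β₁ + ct * β)) * (R * cr) * cr)⁻¹) + c₀ * ((1 - θA * cr)⁻¹ * βQ * cr))))
          + (β + (β₁ + ct * β)) * (1 - (β + (β₁ + ct * β)) * (R * cr) * cr)⁻¹ * ((ℓ * (Real.exp 1 * ε)⁻¹ + 2 * ω) * RN) * cr)) := by positivity
  have h2σ : 2 * σ ≤ δW := by linarith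
  -- the units, per cube
  have hGf := fun k => hasMaj_smoothCut_flat blk (S := Sk k) hβ hβ₁ hct (hχt k) (hsub k) (hcut k)
  have hDf := fun k => hasMaj_jet_smoothCut_flat blk τ n (S := Sk k) hβ hβ₁ hct (hχt k) (hdχt k) (hdχtb k) (hs k) (hsb k) (hdd k) (hddb k) (hcut k) (hcutF k) (hcutB k)
  have hunit := fun k => (hasMaj_dressedV_pair blk htri hd hrow hσ hβb hR hcr hσρ hρ₁V hρ₁G hρ₂ hρ₂₁ (hGf k) (hDf k) (hV k) hq).1
  have hunitW := fun k => isUnit_neumannR (liftBlk blk ι) hd hrow hθA (by linarith) (hW𝒲 k) hqA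
  have hDj : ∀ k, ∀ j, (fun j => Sum.elim (fun μ => fgrad n (liftEquiv (τ μ) ι)) (fun μ => bgrad n (liftEquiv (τ μ) ι)) j ∘ₗ (mulOp (fun p : X × ι => χtX k p.1) ∘ₗ N k)) j = (fun j => Sum.elim (fun μ => fgrad n (liftEquiv (τ μ) ι)) (fun μ => bgrad n (liftEquiv (τ μ) ι)) j) j ∘ₗ (mulOp (fun p : X × ι => χtX k p.1) ∘ₗ N k) := fun _ _ => rfl
  have rate : ∀ (T : Set g.Site) {c ρ' : ℝ}, 0 ≤ c → ρ₃ ≤ ρ' → ∀ y y' : g.Site,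
      ind T y * ind T y' * (c * Real.exp (-(ρ' * g.dist y y'))) ≤ ind T y * ind T y' * (c * Real.exp (-(ρ₃ * g.dist y y'))) :=
    fun T c ρ' hc hρ y y' => mul_le_mul_of_nonneg_left (exp_rate_mono hd hc hρ y y') (mul_nonneg (ind_nonneg _ _) (ind_nonneg _ _))
  -- (1) each dressed cube's two-sided row (file 34) and its cut row (`M_χX = X`), weakened to the rate `ρ₃`
  have hXr : ∀ k, HasMaj (BlockNorm.ofBlocks g (liftBlk blk ι)) (BlockNorm.ofBlocks g (liftBlk blk ι)) (projO none ∘ₗ bgPropV (stack (mulOp (fun p : X × ι => χtX k p.1) ∘ₗ N k) (fun j => Sum.elim (fun μ => fgrad n (liftEquiv (τ μ) ι)) (fun μ => bgrad n (liftEquiv (τ μ) ι)) j ∘ₗ (mulOp (fun p : X × ι => χtX k p.1) ∘ₗ N k))) (unstackM (C k) (A k) + NV k ∘ₗ projO (none : Option (J ⊕ J)))) (fun y y' => ind (Sk k) y * ind (Sk k) y' * (((β + (β₁ + ct * β)) * (1 - (β + (β₁ + ct * β)) * (R * cr) * cr)⁻¹) * Real.exp (-(ρ₃ * g.dist y y'))))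 := fun k =>
    (hasMaj_smoothCutDressed_loc₂ blk τ n htri hd hrow hσ hβ hβ₁ hct hR hcr hσρ hρ₁V hρ₁G hρ₂ hρ₂₁ (hSχ k) (hSψ k) (hχt k) (hdχt k) (hdχtb k) (hsub k) (hχ k) (hs k)
      (hsb k) (hdd k) (hddb k) (hNψ k) (hcut k) (hcutF k) (hcutB k) (hV k) hq).mono (rate (Sk k) hB (by linarith))
  have hGc : ∀ k, HasMaj (BlockNorm.ofBlocks g (liftBlk blk ι)) (BlockNorm.ofBlocks g (liftBlk blk ι)) (mulOp (fun p : X × ι => χX k p.1) ∘ₗ (projO none ∘ₗ bgPropV (stack (mulOp (fun p : X × ι => χtX k p.1) ∘ₗ N k) (fun j => Sum.elim (fun μ => fgrad n (liftEquiv (τ μ) ι)) (fun μ => bgrad n (liftEquiv (τ μ) ι)) j ∘ₗ (mulOp (fun p : X × ι => χtX k p.1) ∘ₗ N k))) (unstackM (C k) (A k) + NV k ∘ₗ projO (none : Option (J ⊕ J))))) (fun y y' => ind (Sk k) y * ind (Sk k) y' * (((β + (β₁ + ct * β)) * (1 - (β + (β₁ + ct * β)) * (R * cr) * cr)⁻¹)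 * Real.exp (-(ρ₃ * g.dist y y')))) := fun k => by
    rw [mulOp_comp_smoothCutDressed τ n (hχ k) (hNψ k) (hunit k)]
    exact hXr k
  -- (2) the sandwiched adjoint right entry `T^X_k = Ñ_𝒲∘M_χ̃∘T⁻_ν` and its row (FILE 153 ★), at the rate `ρ₃`
  have hWχ : ∀ k, mulOp (fun p : X × ι => χX k p.1) ∘ₗ ((mulOp (fun p : X × ι => χtX k p.1) ∘ₗ N k) ∘ₗ (unstackM (C k) (A k) + NV k ∘ₗ projO (none : Option (J ⊕ J))) ∘ₗ
        stack LinearMap.id (fun j => Sum.elim (fun μ => fgrad n (liftEquiv (τ μ) ι)) (fun μ => bgrad n (liftEquiv (τ μ) ι)) j) ∘ₗ mulOp (fun p : X × ι => χX k p.1)) =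
      ((mulOp (fun p : X × ι => χtX k p.1) ∘ₗ N k) ∘ₗ (unstackM (C k) (A k) + NV k ∘ₗ projO (none : Option (J ⊕ J))) ∘ₗ
        stack LinearMap.id (fun j => Sum.elim (fun μ => fgrad n (liftEquiv (τ μ) ι)) (fun μ => bgrad n (liftEquiv (τ μ) ι)) j) ∘ₗ mulOp (fun p : X × ι => χX k p.1)) := fun k => by
    simp only [← LinearMap.comp_assoc]
    rw [hχ k]
  have hTX : ∀ k, HasMaj (BlockNorm.ofBlocks g (liftBlk blk ι)) (BlockNorm.ofBlocks g (liftBlk blk ι)) (neumannR ((mulOp (fun p : X × ι => χtX k p.1) ∘ₗ N k) ∘ₗ (unstackM (C k) (A k) + NV k ∘ₗ projO (none : Option (J ⊕ J))) ∘ₗ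
        stack LinearMap.id (fun j => Sum.elim (fun μ => fgrad n (liftEquiv (τ μ) ι)) (fun μ => bgrad n (liftEquiv (τ μ) ι)) j) ∘ₗ mulOp (fun p : X × ι => χX k p.1)) ∘ₗ (mulOp (fun p : X × ι => χtX k p.1) ∘ₗ Tb k ν)) (fun y y' => ind (Sk k) y * ind (Sk k) y' * (((1 - θA * cr)⁻¹ * βQ * cr) * Real.exp (-(ρ₃ * g.dist y y')))) := fun k =>
    (hasMaj_adjRightEntry_loc₂ blk htri hd hd0 hrow hσ hcr (hSχ k) (hSψ₂ k) (hχt k) (hWχ k) (hχ k) (hTbψ k ν) hβQ hθA h2σ (hW𝒲 k) (hTbr k ν) hqA).mono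
      (rate (Sk k) hBX (by linarith))
  -- (3) the sandwiched covariant-shaped entry `T₂,k`, its row (FILE 157 ★), and the cut `M_χT₂,k`
  have hT2 : ∀ k, HasMaj (BlockNorm.ofBlocks g (liftBlk blk ι)) (BlockNorm.ofBlocks g (liftBlk blk ι)) ((neumannR ((mulOp (fun p : X × ι => χtX k p.1) ∘ₗ N k) ∘ₗ (unstackM (C k) (A k) + NV k ∘ₗ projO (none : Option (J ⊕ J))) ∘ₗ
        stack LinearMap.id (fun j => Sum.elim (fun μ => fgrad n (liftEquiv (τ μ) ι)) (fun μ => bgrad n (liftEquiv (τ μ) ι)) j) ∘ₗ mulOp (fun p : X × ι => χX k p.1)) ∘ₗ (mulOp (fun p : X × ι => χtX k p.1) ∘ₗ Tb k ν)) ∘ₗ mmulOp ((fun x => ug k x * (ug k ((τ ν).symm x))ᵀ) ∘ ⇑(τ ν)) - (projO none ∘ₗ bgPropV (stack (mulOp (fun p : X × ι => χtX k p.1) ∘ₗ N k) (fun j => Sum.elim (fun μ => fgrad n (liftEquiv (τ μ) ι)) (fun μ => bgrad n (liftEquiv (τ μ) ι)) j ∘ₗ (mulOp (fun p : X × ι =>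 χtX k p.1) ∘ₗ N k))) (unstackM (C k) (A k) + NV k ∘ₗ projO (none : Option (J ⊕ J)))) ∘ₗ mmulOp (fgradMat n (τ ν) (fun x => ug k x * (ug k ((τ ν).symm x))ᵀ)) + (projO none ∘ₗ bgPropV (stack (mulOp (fun p : X × ι => χtX k p.1) ∘ₗ N k) (fun j => Sum.elim (fun μ => fgrad n (liftEquiv (τ μ) ι)) (fun μ => bgrad n (liftEquiv (τ μ) ι)) j ∘ₗ (mulOp (fun p : X × ι => χtX k p.1) ∘ₗ N k))) (unstackM (C k) (A k) + NV k ∘ₗ projO (none : Option (J ⊕ J)))) ∘ₗ mmulOp (fun x => ug k x * fgradMat n (τ ν) (fun y => (ug k ((τ ν).symm y))ᵀ) x)) (fun y y' => ind (Sk k) y * ind (Sk k) y' * ((((1 - θA * cr)⁻¹ * βQ * cr) * rR + ((β + (β₁ + ct * β)) * (1 - (β + (β₁ + ct * β)) * (R * cr) * cr)⁻¹) * rR' + ((β + (β₁ + ct * β)) * (1 - (β + (β₁ + ct * β)) * (R * cr) * cr)⁻¹) * rB) * Real.exp (-(ρ₃ * g.dist y y')))) := fun k =>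
    hasMaj_covShapeEntry_loc₂ blk hB hBX hrR hrR' hrB (hR1 k) (hR1' k) (hB1 k) (hXr k) (hTX k)
  have hT' : ∀ k, HasMaj (BlockNorm.ofBlocks g (liftBlk blk ι)) (BlockNorm.ofBlocks g (liftBlk blk ι)) (mulOp (fun p : X × ι => χX k p.1) ∘ₗ ((neumannR ((mulOp (fun p : X × ι => χtX k p.1) ∘ₗ N k) ∘ₗ (unstackM (C k) (A k) + NV k ∘ₗ projO (none : Option (J ⊕ J))) ∘ₗ
        stack LinearMap.id (fun j => Sum.elim (fun μ => fgrad n (liftEquiv (τ μ) ι)) (fun μ => bgrad n (liftEquiv (τ μ) ι)) j) ∘ₗ mulOp (fun p : X × ι => χX k p.1)) ∘ₗ (mulOp (fun p : X × ι => χtX k p.1) ∘ₗ Tb k ν)) ∘ₗ mmulOp ((fun x => ug k x * (ug k ((τ ν).symm x))ᵀ) ∘ ⇑(τ ν)) - (projO none ∘ₗ bgPropV (stack (mulOp (fun p : X × ι => χtX k p.1) ∘ₗ N k) (fun j => Sum.elim (fun μ => fgrad n (liftEquiv (τ μ) ι)) (fun μ => bgrad n (liftEquiv (τ μ) ι)) j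 ∘ₗ (mulOp (fun p : X × ι => χtX k p.1) ∘ₗ N k))) (unstackM (C k) (A k) + NV k ∘ₗ projO (none : Option (J ⊕ J)))) ∘ₗ mmulOp (fgradMat n (τ ν) (fun x => ug k x * (ug k ((τ ν).symm x))ᵀ)) + (projO none ∘ₗ bgPropV (stack (mulOp (fun p : X × ι => χtX k p.1) ∘ₗ N k) (fun j => Sum.elim (fun μ => fgrad n (liftEquiv (τ μ) ι)) (fun μ => bgrad n (liftEquiv (τ μ) ι)) j ∘ₗ (mulOp (fun p : X × ι => χtX k p.1) ∘ₗ N k))) (unstackM (C k) (A k) + NV k ∘ₗ projO (none : Option (J ⊕ J)))) ∘ₗ mmulOp (fun x => ug k x * fgradMat n (τ ν) (fun y => (ug k ((τ ν).symm y))ᵀ) x))) (fun y y' => ind (Sk k) y * ind (Sk k) y' * ((((1 - θA * cr)⁻¹ * βQ * cr) * rR + ((β + (β₁ + ct * β)) * (1 - (β + (β₁ + ct * β)) * (R * cr) * cr)⁻¹) * rR' + ((β + (β₁ + ct * β)) * (1 - (β + (β₁ + ct * β)) * (R * cr) * cr)⁻¹) * rB) * Real.exp (-(ρ₃ * g.dist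 y y')))) := fun k =>
    (hasMaj_diag_comp (liftBlk blk ι) (fun _ => zero_le_one) (hasMaj_mulOp (g := g) (liftBlk blk ι) (m := fun _ => (1 : ℝ)) (fun _ => zero_le_one) (fun p : X × ι => hχ1 k p.1))
      (hT2 k)).mono fun y y' => le_of_eq (one_mul _)
  -- (4) the sandwich against the conjugated gradient `M_{u_k}∇⁻_νM_{u_kᵀ}` (FILE 162 ★★)
  have hE2' : ∀ k, mulOp (fun p : X × ι => χX k p.1) ∘ₗ (projO none ∘ₗ bgPropV (stack (mulOp (fun p : X × ι => χtX k p.1) ∘ₗ N k) (fun j => Sum.elim (fun μ => fgrad n (liftEquiv (τ μ) ι)) (fun μ => bgrad n (liftEquiv (τ μ) ι)) j ∘ₗ (mulOp (fun p : X × ι => χtX k p.1) ∘ₗ N k))) (unstackM (C k) (A k) + NV k ∘ₗ projO (none : Option (J ⊕ J)))) ∘ₗ (mmulOp (ug k) ∘ₗ bgrad n (liftEquiv (τ ν) ι) ∘ₗ mmulOp (fun x => (ug k x)ᵀ)) ∘ₗ mulOp (fun p : X × ι => hX k (τ ν p.1)) =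
      (mulOp (fun p : X × ι => χX k p.1) ∘ₗ ((neumannR ((mulOp (fun p : X × ι => χtX k p.1) ∘ₗ N k) ∘ₗ (unstackM (C k) (A k) + NV k ∘ₗ projO (none : Option (J ⊕ J))) ∘ₗ
        stack LinearMap.id (fun j => Sum.elim (fun μ => fgrad n (liftEquiv (τ μ) ι)) (fun μ => bgrad n (liftEquiv (τ μ) ι)) j) ∘ₗ mulOp (fun p : X × ι => χX k p.1)) ∘ₗ (mulOp (fun p : X × ι => χtX k p.1) ∘ₗ Tb k ν)) ∘ₗ mmulOp ((fun x => ug k x * (ug k ((τ ν).symm x))ᵀ) ∘ ⇑(τ ν)) - (projO none ∘ₗ bgPropV (stack (mulOp (fun p : X × ι => χtX k p.1) ∘ₗ N k) (fun j => Sum.elim (fun μ => fgrad n (liftEquiv (τ μ) ι)) (fun μ => bgrad n (liftEquiv (τ μ) ι)) j ∘ₗ (mulOp (fun p : X × ι => χtX k p.1) ∘ₗ N k))) (unstackM (C k) (A k) + NV k ∘ₗ projO (none : Option (J ⊕ J)))) ∘ₗ mmulOp (fgradMat n (τ ν) (fun x => ug k x * (ug k ((τ ν).symm x))ᵀ)) +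 (projO none ∘ₗ bgPropV (stack (mulOp (fun p : X × ι => χtX k p.1) ∘ₗ N k) (fun j => Sum.elim (fun μ => fgrad n (liftEquiv (τ μ) ι)) (fun μ => bgrad n (liftEquiv (τ μ) ι)) j ∘ₗ (mulOp (fun p : X × ι => χtX k p.1) ∘ₗ N k))) (unstackM (C k) (A k) + NV k ∘ₗ projO (none : Option (J ⊕ J)))) ∘ₗ mmulOp (fun x => ug k x * fgradMat n (τ ν) (fun y => (ug k ((τ ν).symm y))ᵀ) x))) ∘ₗ mulOp (fun p : X × ι => hX k (τ ν p.1)) := fun k =>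
    smoothCutDressed_gaugeConj_bgrad_sandwich τ n (hDj k) (hunit k) (hχ k) (hunitW k) (τ ν) (ug k) (hTb k ν) (a := fun p : X × ι => hX k (τ ν p.1))
      (c := fun p : X × ι => χX k p.1) (fun p hp => hlayν k p.1 hp)
  -- (5) the adjoint remainder row in the cube's gauge: FILE 153 ★★★ against the model operator plus the far row
  have hK' : ∀ k, HasMaj (BlockNorm.ofBlocks g (liftBlk blk ι)) (BlockNorm.ofBlocks g (liftBlk blk ι)) ((projO none ∘ₗ bgPropV (stack (mulOp (fun p : X × ι => χtX k p.1) ∘ₗ N k) (fun j => Sum.elim (fun μ => fgrad n (liftEquiv (τ μ) ι)) (fun μ => bgrad n (liftEquiv (τ μ) ι)) j ∘ₗ (mulOp (fun p : X × ι => χtX k p.1) ∘ₗ N k))) (unstackM (C k) (A k) + NV k ∘ₗ projO (none : Option (J ⊕ J)))) ∘ₗ commOp (mmulOp (ug k) ∘ₗ Δ ∘ₗ mmulOp (fun x => (ug k x)ᵀ)) (fun p : X × ι => hX k p.1))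
      (fun y y' => ind (Sk k) y * (((((((Fintype.card J : ℝ) * (3 * ((β + (β₁ + ct * β)) * (1 - (β + (β₁ + ct * β)) * (R * cr) * cr)⁻¹ * c₂) + 2 * (((1 - θA * cr)⁻¹ * βQ * cr) * c₁)) + θW)
          + (β + (β₁ + ct * β)) * (1 - (β + (β₁ + ct * β)) * (R * cr) * cr)⁻¹ * cN * cr)
        + (((Fintype.card J : ℝ) * (2 * rA * (c₁ * ((β + (β₁ + ct * β)) * (1 - (β + (β₁ + ct * β)) * (R * cr) * cr)⁻¹) + c₀ * ((1 - θA * cr)⁻¹ * βQ * cr))))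
          + (β + (β₁ + ct * β)) * (1 - (β + (β₁ + ct * β)) * (R * cr) * cr)⁻¹ * ((ℓ * (Real.exp 1 * ε)⁻¹ + 2 * ω) * RN) * cr))) + θF) * Real.exp (-(ρ₃ * g.dist y y')))) := fun k => by
    rw [hcov k, commOp_add_left, LinearMap.comp_add]
    have h153 := hasMaj_smoothCutDressed_comp_commOp_cubeOp_out_of_sandwich blk τ n htri hd hsymm hd0 hrow hσ hβ hβ₁ hβQ hct hR hcr hc₀ hc₁ hc₂ hθW hcN hrA hRN hℓ hω hθA hε
      hσρ hρ₁V hρ₁G hρ₂ hρ₂₁ hρ₃ hρ₃N hρ₃V hρ₃₂ hρ₂W (hSχ k) (hSψ k) (hSψ₂ k) (hχt k) (hdχt k) (hdχtb k) (hsub k) (hχ k) (hs k) (hsb k) (hdd k) (hddb k) (hNψ k)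
      (hcut k) (hcutF k) (hcutB k) (hTf k) (hTb k) (hTfr k) (hTbr k) (hTfψ k) (hTbψ k) (hV k) hq (hW𝒲 k) hqA (hh1 k) (hh1b k) (hh0 k) (hLip k) (hrh k) (hh2 k) (hh2f k) (hh2b k)
      (hlayf k) (hlayb k) (hA k) (hWrow k) (hKN k) (hNV k)
    exact (h153.add (hFK k)).mono fun y y' => le_of_eq (by ring)
  -- (6) the scalar adjoint Leibniz rule of `∇⁻_ν`
  have hleib : ∀ k, mulOp (fun p : X × ι => hX k p.1) ∘ₗ bgrad n (liftEquiv (τ ν) ι) =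
      bgrad n (liftEquiv (τ ν) ι) ∘ₗ mulOp (fun p : X × ι => hX k (τ ν p.1)) + mulOp (fun p : X × ι => -(fgrad n (τ ν) (hX k) p.1)) := fun k =>
    mulOp_fst_comp_bgrad_leib n (τ ν) (hX k)
  -- FILE 160
  have hΘF : 0 ≤ (((((Fintype.card J : ℝ) * (3 * ((β + (β₁ + ct * β)) * (1 - (β + (β₁ + ct * β)) * (R * cr) * cr)⁻¹ * c₂) + 2 * (((1 - θA * cr)⁻¹ * βQ * cr) * c₁)) + θW)
          + (β + (β₁ + ct * β)) * (1 - (β + (β₁ + ct * β)) * (R * cr) * cr)⁻¹ * cN * cr)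
        + (((Fintype.card J : ℝ) * (2 * rA * (c₁ * ((β + (β₁ + ct * β)) * (1 - (β + (β₁ + ct * β)) * (R * cr) * cr)⁻¹) + c₀ * ((1 - θA * cr)⁻¹ * βQ * cr))))
          + (β + (β₁ + ct * β)) * (1 - (β + (β₁ + ct * β)) * (R * cr) * cr)⁻¹ * ((ℓ * (Real.exp 1 * ε)⁻¹ + 2 * ω) * RN) * cr))) + θF := add_nonneg hΘ hθF
  have hβ2 : 0 ≤ (((1 - θA * cr)⁻¹ * βQ * cr) * rR + ((β + (β₁ + ct * β)) * (1 - (β + (β₁ + ct * β)) * (R * cr) * cr)⁻¹) * rR' + ((β + (β₁ + ct * β)) * (1 - (β + (β₁ + ct * β)) * (R * cr) * cr)⁻¹) * rB) := by positivity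
  exact hasMaj_gluedL_comp_of_localGauges blk Sk ug Δ (bgrad n (liftEquiv (τ ν) ι)) hX χX (fun k x => hX k (τ ν x))
    (fun k => (projO none ∘ₗ bgPropV (stack (mulOp (fun p : X × ι => χtX k p.1) ∘ₗ N k) (fun j => Sum.elim (fun μ => fgrad n (liftEquiv (τ μ) ι)) (fun μ => bgrad n (liftEquiv (τ μ) ι)) j ∘ₗ (mulOp (fun p : X × ι => χtX k p.1) ∘ₗ N k))) (unstackM (C k) (A k) + NV k ∘ₗ projO (none : Option (J ⊕ J)))))
    (fun k => (mulOp (fun p : X × ι => χX k p.1) ∘ₗ ((neumannR ((mulOp (fun p : X × ι => χtX k p.1) ∘ₗ N k) ∘ₗ (unstackM (C k) (A k) + NV k ∘ₗ projO (none : Option (J ⊕ J))) ∘ₗ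
        stack LinearMap.id (fun j => Sum.elim (fun μ => fgrad n (liftEquiv (τ μ) ι)) (fun μ => bgrad n (liftEquiv (τ μ) ι)) j) ∘ₗ mulOp (fun p : X × ι => χX k p.1)) ∘ₗ (mulOp (fun p : X × ι => χtX k p.1) ∘ₗ Tb k ν)) ∘ₗ mmulOp ((fun x => ug k x * (ug k ((τ ν).symm x))ᵀ) ∘ ⇑(τ ν)) - (projO none ∘ₗ bgPropV (stack (mulOp (fun p : X × ι => χtX k p.1) ∘ₗ N k) (fun j => Sum.elim (fun μ => fgrad n (liftEquiv (τ μ) ι)) (fun μ => bgrad n (liftEquiv (τ μ) ι)) j ∘ₗ (mulOp (fun p : X × ι => χtX k p.1) ∘ₗ N k))) (unstackM (C k) (A k) + NV k ∘ₗ projO (none : Option (J ⊕ J)))) ∘ₗ mmulOp (fgradMat n (τ ν) (fun x => ug k x * (ug k ((τ ν).symm x))ᵀ)) + (projO none ∘ₗ bgPropV (stack (mulOp (fun p : X × ι => χtX k p.1) ∘ₗ N k) (fun j => Sum.elim (fun μ => fgrad n (liftEquiv (τ μ) ι)) (fun μ => bgrad n (liftEquiv (τ μ) ι)) j ∘ₗ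 (mulOp (fun p : X × ι => χtX k p.1) ∘ₗ N k))) (unstackM (C k) (A k) + NV k ∘ₗ projO (none : Option (J ⊕ J)))) ∘ₗ mmulOp (fun x => ug k x * fgradMat n (τ ν) (fun y => (ug k ((τ ν).symm y))ᵀ) x))))
    (fun k => ((projO none ∘ₗ bgPropV (stack (mulOp (fun p : X × ι => χtX k p.1) ∘ₗ N k) (fun j => Sum.elim (fun μ => fgrad n (liftEquiv (τ μ) ι)) (fun μ => bgrad n (liftEquiv (τ μ) ι)) j ∘ₗ (mulOp (fun p : X × ι => χtX k p.1) ∘ₗ N k))) (unstackM (C k) (A k) + NV k ∘ₗ projO (none : Option (J ⊕ J)))) ∘ₗ F k ∘ₗ mulOp (fun p : X × ι => hX k p.1)))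
    htri hd hd0 hrow hσ hug hug' (dh := fun k x => -(fgrad n (τ ν) (hX k) x)) hB hβ2 zero_le_one hc₁ hΘF hεF hNov hσρ₃ hleib hhcut hE2' hhabs (fun k x => hhabs k (τ ν x))
    (fun k x => by rw [abs_neg]; exact hh1 k ν x) hN hGc hT' hK' hFX hqL

end Capstone

end Summit.QuantumFields.YangMills.BalabanUVNodes.N15.Gluing

end
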